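/-
Origin: expansion seat `planner-pub-hodgecm-qw8-g11-0`, handover #32 SPLIT PART 2/2 = REPLACE tree `HodgeCM/Model/Toy/LefExamples.lean` 7cb17540 (400 l.) by md5 2429c457c53f97c4df9b5817be67faa4 (219 l.): keeps the module name + module docstring, §§1–3 moved verbatim to row #31 (LefCyclotomic), §§4–5 + docstrings (debt 26 → 0); ONE rewrite: `import Qw8g11.LefCyclotomic` -> `import HodgeCM.Model.Toy.LefCyclotomic` (row #31); union of the parts' comment-stripped c (`HOME/pub-hodgecm-qw8-g11/lean/Qw8g11/LefExamples.lean`, md5 2429c457, 219 lines);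
landed by the packager successor (mc-unitary-1-g3, gen-8 kit) in gate run 32 REPLACES the earlier landed copy of `HodgeCM/Model/Toy/LefExamples.lean` (import ^import Qw8g11\.LefCyclotomic[ \t]*$→import HodgeCM.Model.Toy.LefCyclotomic ×1).
-/
-- HANDOVER (planner-pub-hodgecm-qw8-g11-0, unit pub-hodgecm-qw8-g11): SPLIT PART 2/2 = REPLACEMENT of the tree file
-- `HodgeCM.Model.Toy.LefExamples` (RUN-31 install, md5 7cb17540, 400 l.): §§4–5 (ll. 237–398) verbatim + docstrings; §§1–3 moved to
-- `LefCyclotomic`; at landing rewrite `import Qw8g11.LefCyclotomic` ↦ `import HodgeCM.Model.Toy.LefCyclotomic` (lands AFTER part 1);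
-- the importer `LefNonNormalExample` is unaffected (same module name, same declarations).
/-
Copyright (c) 2026. All rights reserved.
Released under Apache 2.0 license as described in the file LICENSE.
-/
import Summits.HodgeConjecture.HodgeCM.Model.Toy.LefCyclotomic

/-!
# Decided instances of the mixing criterion: cyclotomic CM fields

(Split for the 400-line cap: §§1–3 of this file — cyclotomic CM fields, the `NonGenReal` instances and `PartialConj` by roots
of unity — are now the module `HodgeCM.Model.Toy.LefCyclotomic`, imported here; §§4–5 below are unchanged.)

`LefPartialConjGalois` / `LefClosureExclusive` / `LefNormalPartner` / `LefNonGenReal` decide `PartialConj K₁ K₂` —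
and with it (`LefPartialConj`) HC in `lefModel` for products of CM objects presented over `K₁` and `K₂` (degrees
`≤ 4`) — from field-theoretic data of the two Galois closures.  No CM field is constructed there.  This file supplies
CONCRETE INSTANCES, on the cyclotomic CM fields `ℚ(ζₙ) = CyclotomicField n ℚ`:

* §1 `ℚ(ζₙ)` (`2 < n`) is a CM field (Mathlib), normal, of degree `φ(n)`; bundled as `cyc n : CMField` (the numeral
  facts `Fact (2 < n)` are instances SCOPED to `HodgeCM.Toy`); `Gal(ℚ(ζ₅)/ℚ)` is cyclic.
* §2 `NonGenReal ℚ(ζ₅)` (cyclic quartic, `LefNonGenReal.nonGenReal_of_isCyclic`), `NonGenReal ℚ(ζ₃)`, `NonGenReal ℚ(ζ₄)`,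
  `ClosureExclusive ℚ(ζ₅)`.
* §3 **`PartialConj` decided by roots of unity.** `liftK_not_mem_galClosure_of_isPrimitiveRoot`: if `K₁` is normal
  and contains a primitive `n`-th root of unity, `y ∈ K₂` is a primitive `m`-th root and `φ(lcm n m) > [K₁:ℚ]`,
  then no embedding of `K₂` maps `y` into `galClosure K₁`; hence (normal-partner criterion)
  `PartialConj ℚ(ζₙ) ℚ(ζₘ)` for `(n, m) ∈ {(3,4), (3,5), (4,5), (5,8), (5,12), (3,8), (5,7), (3,7), (4,7)}` and
  symmetric — including partners `ℚ(ζ₇)` of degree `6` and the biquadratic `ℚ(ζ₈)`, `ℚ(ζ₁₂)` as FIRST field.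
* §4 **Negative instances.** `¬ NonGenReal ℚ(ζ₈)`, `¬ NonGenReal ℚ(ζ₁₂)` (`ζ₈² = i`, `ζ₁₂³ = i` are non-real
  non-generators); `¬ PartialConj ℚ(ζ₈) ℚ(ζ₁₂)` (both closures contain `i`), `¬ PartialConj ℚ(ζ₈) ℚ(ζ₄)`,
  `¬ PartialConj ℚ(ζ₁₂) ℚ(ζ₃)`, `¬ PartialConj ℚ(ζ₅) ℚ(ζ₅)`; `¬ ClosureExclusive ℚ(ζ₈)` (so `NonGenReal` cannot be dropped).
* §5 **Model headlines decided**: HC in `lefModel` for every product of CM objects presented over `ℚ(ζ₈)` and `ℚ(ζ₅)`,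
  `ℚ(ζ₁₂)`–`ℚ(ζ₅)`, `ℚ(ζ₈)`–`ℚ(ζ₃)`, `ℚ(ζ₅)`–`ℚ(ζ₃)`, `ℚ(ζ₅)`–`ℚ(ζ₄)`, for ALL pairs of CM types, and for every finite product
  of CM abelian varieties with CM by `ℚ(ζ₃)`, `ℚ(i)`, `ℚ(ζ₅)` (`lef_hc_prodFin_cmObj_cyc345`) — no hypothesis left.

Kernel-checked from Mathlib (`IsCyclotomicExtension.Rat.isCMField`, `IsPrimitiveRoot.lcm_totient_le_finrank`,
`IsCyclotomicExtension.autEquivPow`, `ZMod.isCyclic_units_prime`) on top of the qw8-g9 files; nothing cited; no data.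
-/

noncomputable section
set_option backward.isDefEq.respectTransparency false
namespace HodgeCM.Toy

open Literature.AlgebraicGeometry.Motives (CMType)
open NumberField.ComplexEmbedding (conjugate)
open IsCyclotomicExtension (zeta zeta_spec)
open Polynomial (cyclotomic)

/-! ### 4. Negative instances -/

section Negative

variable {K : Type} [Field K] [NumberField K]
variable {K₁ K₂ : Type} [Field K₁] [NumberField K₁] [Field K₂] [NumberField K₂]

/-- a field containing `i` is `NonGenReal` only if it is `ℚ(i)`: `i` is a non-real element of degree `2` -/
theorem not_nonGenReal_of_isPrimitiveRoot_four {y : K} (hy : IsPrimitiveRoot y 4)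
    (hK : Module.finrank ℚ K ≠ 2) : ¬ NonGenReal K := by
  intro h
  obtain ⟨b⟩ := (inferInstance : Nonempty (K →+* ℂ))
  have hne : IntermediateField.adjoin ℚ {y} ≠ ⊤ := by
    intro htop
    apply hK
    have h1 := IntermediateField.adjoin.finrank (Algebra.IsIntegral.isIntegral (R := ℚ) y)
    rw [htop, IntermediateField.finrank_top', ← Polynomial.cyclotomic_eq_minpoly_rat hy (by norm_num),
      Polynomial.natDegree_cyclotomic] at h1
    rw [h1]; decide
  exact conj_ne_of_isPrimitiveRoot (hy.map_of_injective b.injective) (by norm_num) (h y hne b)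

/-- `ζ₈²` is a primitive fourth root of unity -/
theorem isPrimitiveRoot_zeta8_sq : IsPrimitiveRoot (zeta 8 ℚ (CyclotomicField 8 ℚ) ^ 2) 4 :=
  (zeta_spec 8 ℚ _).pow (by norm_num) (by norm_num)

/-- `ζ₁₂³` is a primitive fourth root of unity -/
theorem isPrimitiveRoot_zeta12_cube : IsPrimitiveRoot (zeta 12 ℚ (CyclotomicField 12 ℚ) ^ 3) 4 :=
  (zeta_spec 12 ℚ _).pow (by norm_num) (by norm_num)

/-- `ζ₁₂⁴` is a primitive cube root of unity -/
theorem isPrimitiveRoot_zeta12_pow_four : IsPrimitiveRoot (zeta 12 ℚ (CyclotomicField 12 ℚ) ^ 4) 3 :=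
  (zeta_spec 12 ℚ _).pow (by norm_num) (by norm_num)

/-- **`ℚ(ζ₈) = ℚ(i, √2)` is not `NonGenReal`** (biquadratic) -/
theorem not_nonGenReal_cyc8 : ¬ NonGenReal (CyclotomicField 8 ℚ) :=
  not_nonGenReal_of_isPrimitiveRoot_four isPrimitiveRoot_zeta8_sq (by rw [finrank_cyc8]; norm_num)

/-- **`ℚ(ζ₁₂) = ℚ(i, √3)` is not `NonGenReal`** -/
theorem not_nonGenReal_cyc12 : ¬ NonGenReal (CyclotomicField 12 ℚ) :=
  not_nonGenReal_of_isPrimitiveRoot_four isPrimitiveRoot_zeta12_cube (by rw [finrank_cyc12]; norm_num)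

/-- **`ℚ(ζ₈)` and `ℚ(ζ₁₂)` do not mix**: both Galois closures contain `ℚ(i)` -/
theorem not_partialConj_cyc8_cyc12 : ¬ PartialConj (CyclotomicField 8 ℚ) (CyclotomicField 12 ℚ) :=
  not_partialConj_of_isPrimitiveRoot isPrimitiveRoot_zeta8_sq isPrimitiveRoot_zeta12_cube (by norm_num)

/-- `¬ PartialConj ℚ(ζ₁₂) ℚ(ζ₈)` (both Galois closures contain `i`) -/
theorem not_partialConj_cyc12_cyc8 : ¬ PartialConj (CyclotomicField 12 ℚ) (CyclotomicField 8 ℚ) :=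
  fun h => not_partialConj_cyc8_cyc12 h.symm

/-- `ℚ(i) ⊂ ℚ(ζ₈)`: no mixing -/
theorem not_partialConj_cyc8_cyc4 : ¬ PartialConj (CyclotomicField 8 ℚ) (CyclotomicField 4 ℚ) :=
  not_partialConj_of_isPrimitiveRoot isPrimitiveRoot_zeta8_sq (zeta_spec 4 ℚ _) (by norm_num)

/-- `ℚ(i) ⊂ ℚ(ζ₁₂)` -/
theorem not_partialConj_cyc12_cyc4 : ¬ PartialConj (CyclotomicField 12 ℚ) (CyclotomicField 4 ℚ) :=
  not_partialConj_of_isPrimitiveRoot isPrimitiveRoot_zeta12_cube (zeta_spec 4 ℚ _) (by norm_num)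

/-- `ℚ(ζ₃) ⊂ ℚ(ζ₁₂)` -/
theorem not_partialConj_cyc12_cyc3 : ¬ PartialConj (CyclotomicField 12 ℚ) (CyclotomicField 3 ℚ) :=
  not_partialConj_of_isPrimitiveRoot isPrimitiveRoot_zeta12_pow_four (zeta_spec 3 ℚ _) (by norm_num)

/-- and of course no field mixes with itself (`ℚ(ζ₅)` twice) -/
theorem not_partialConj_cyc5_cyc5 : ¬ PartialConj (CyclotomicField 5 ℚ) (CyclotomicField 5 ℚ) :=
  not_partialConj_of_isPrimitiveRoot (zeta_spec 5 ℚ _) (zeta_spec 5 ℚ _) (by norm_num)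

/-- **`ClosureExclusive` fails for the biquadratic field `ℚ(ζ₈)`**: `x = i = b(ζ₈²)` lies in `galClosure ℚ(ζ₈)`,
is not real, and `ℚ(i)` is normal of degree `2 < 4 = [galClosure ℚ(ζ₈) : ℚ]`. So the hypothesis `NonGenReal` of
`closureExclusive_of_normal` (qw8-g9) cannot be dropped, even for normal quartic CM fields. -/
theorem not_closureExclusive_cyc8 : ¬ ClosureExclusive (CyclotomicField 8 ℚ) := by
  intro h
  obtain ⟨b⟩ := (inferInstance : Nonempty (CyclotomicField 8 ℚ →+* ℂ))
  obtain ⟨y, hy⟩ : ∃ y : CyclotomicField 8 ℚ, IsPrimitiveRoot y 4 := ⟨_, isPrimitiveRoot_zeta8_sq⟩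
  have hx : IsPrimitiveRoot (liftK b y) 4 := hy.map_of_injective (liftK b).injective
  rcases h _ (liftK_mem_galClosure _ b y) with h1 | h2
  · refine conj_ne_of_isPrimitiveRoot (hy.map_of_injective b.injective) (by norm_num) ?_
    have h1' := congrArg (fun z : Qbar => (z : ℂ)) h1
    simpa only [Obj.coe_kap, coe_liftK] using h1'
  · have hint : IsIntegral ℚ (liftK b y) := Algebra.IsIntegral.isIntegral _
    have hE : Module.finrank ℚ ↥(IntermediateField.adjoin ℚ {liftK b y}) = 2 := by
      rw [IntermediateField.adjoin.finrank hint, ← Polynomial.cyclotomic_eq_minpoly_rat hx (by norm_num),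
        Polynomial.natDegree_cyclotomic]
      decide
    haveI : Algebra.IsQuadraticExtension ℚ ↥(IntermediateField.adjoin ℚ {liftK b y}) :=
      { finrank_eq_two' := hE }
    have hN : Normal ℚ ↥(IntermediateField.adjoin ℚ {liftK b y}) := inferInstance
    haveI : FiniteDimensional ℚ ↥(IntermediateField.adjoin ℚ {liftK b y}) :=
      Module.finite_of_finrank_eq_succ hE
    -- the `Normal` instance is passed explicitly (the `Field ↥E` instance paths differ)
    have h3 : galClosure (CyclotomicField 8 ℚ) ≤ IntermediateField.adjoin ℚ {liftK b y} :=
      h2.trans (@IntermediateField.normalClosure_of_normal _ _ _ _ _ _ hN).le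
    have h4 := IntermediateField.finrank_le_of_le_right h3
    rw [finrank_galClosure, hE, finrank_cyc8] at h4
    omega

end Negative

/-! ### 5. Model headlines decided -/

section Headlines

/-- **HC decided, `ℚ(ζ₈) × ℚ(ζ₅)`**: every product of a CM object presented over the biquadratic `ℚ(ζ₈)` with one
presented over the cyclic quartic `ℚ(ζ₅)` satisfies HC in `lefModel` — for every pair of CM types. -/
theorem lef_hc_prod_of_presented_cyc8_cyc5 {X Y : Obj} (hX : X.Presented (cyc 8)) (hY : Y.Presented (cyc 5)) :
    lefModel.HC (X.prod Y) :=
  lef_hc_prod_of_presented_of_normal (cyc 8) (cyc 5) nonGenReal_cyc5 (not_galClosure_cyc_le (by decide))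
    finrank_cyc8.le finrank_cyc5.le hX hY

/-- HC in `lefModel` for `A_{(ℚ(ζ₈),Φ)} × A_{(ℚ(ζ₅),Φ')}`, all pairs of CM types -/
theorem lef_hc_cmObj_cyc8_prod_cmObj_cyc5 (Φ : CMType (cyc 8)) (Φ' : CMType (cyc 5)) :
    lefModel.HC ((cmObj (cyc 8) Φ).prod (cmObj (cyc 5) Φ')) :=
  lef_hc_cmObj_prod_cmObj_of_normal (cyc 8) (cyc 5) nonGenReal_cyc5 (not_galClosure_cyc_le (by decide))
    finrank_cyc8.le finrank_cyc5.le Φ Φ'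

/-- **`ℚ(ζ₁₂) × ℚ(ζ₅)`** -/
theorem lef_hc_cmObj_cyc12_prod_cmObj_cyc5 (Φ : CMType (cyc 12)) (Φ' : CMType (cyc 5)) :
    lefModel.HC ((cmObj (cyc 12) Φ).prod (cmObj (cyc 5) Φ')) :=
  lef_hc_cmObj_prod_cmObj_of_normal (cyc 12) (cyc 5) nonGenReal_cyc5 (not_galClosure_cyc_le (by decide))
    finrank_cyc12.le finrank_cyc5.le Φ Φ'

/-- **`ℚ(ζ₈) × ℚ(ζ₃)`**: CM abelian surfaces with CM by `ℚ(ζ₈)` times CM elliptic curves with CM by `ℚ(√-3)` -/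
theorem lef_hc_cmObj_cyc8_prod_cmObj_cyc3 (Φ : CMType (cyc 8)) (Φ' : CMType (cyc 3)) :
    lefModel.HC ((cmObj (cyc 8) Φ).prod (cmObj (cyc 3) Φ')) :=
  lef_hc_cmObj_prod_cmObj_of_normal (cyc 8) (cyc 3) nonGenReal_cyc3 (not_galClosure_cyc_le (by decide))
    finrank_cyc8.le (finrank_cyc3.le.trans (by norm_num)) Φ Φ'

/-- **`ℚ(ζ₅) × ℚ(ζ₃)`**, **`ℚ(ζ₅) × ℚ(i)`** -/
theorem lef_hc_cmObj_cyc5_prod_cmObj_cyc3 (Φ : CMType (cyc 5)) (Φ' : CMType (cyc 3)) :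
    lefModel.HC ((cmObj (cyc 5) Φ).prod (cmObj (cyc 3) Φ')) :=
  lef_hc_cmObj_prod_cmObj_of_normal (cyc 5) (cyc 3) nonGenReal_cyc3 (not_galClosure_cyc_le (by decide))
    finrank_cyc5.le (finrank_cyc3.le.trans (by norm_num)) Φ Φ'

/-- HC in `lefModel` for `A_{(ℚ(ζ₅),Φ)} × A_{(ℚ(i),Φ')}`, all pairs of CM types -/
theorem lef_hc_cmObj_cyc5_prod_cmObj_cyc4 (Φ : CMType (cyc 5)) (Φ' : CMType (cyc 4)) :
    lefModel.HC ((cmObj (cyc 5) Φ).prod (cmObj (cyc 4) Φ')) :=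
  lef_hc_cmObj_prod_cmObj_of_normal (cyc 5) (cyc 4) nonGenReal_cyc4 (not_galClosure_cyc_le (by decide))
    finrank_cyc5.le (finrank_cyc4.le.trans (by norm_num)) Φ Φ'

/-- the three closure-exclusive cyclotomic CM fields of degree `≤ 4` -/
def cyc345 : Fin 3 → CMField := ![cyc 3, cyc 4, cyc 5]

/-- the three fields `ℚ(ζ₃)`, `ℚ(i)`, `ℚ(ζ₅)` have degree `≤ 4` -/
theorem finrank_cyc345_le (a : Fin 3) : Module.finrank ℚ (cyc345 a) ≤ 4 := by
  fin_cases a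
  · exact finrank_cyc3.le.trans (by norm_num)
  · exact finrank_cyc4.le.trans (by norm_num)
  · exact finrank_cyc5.le

/-- any two distinct fields among `ℚ(ζ₃)`, `ℚ(i)`, `ℚ(ζ₅)` have a partial conjugation -/
theorem partialConj_cyc345 (a b : Fin 3) (hab : a ≠ b) : PartialConj (cyc345 a) (cyc345 b) := by
  fin_cases a <;> fin_cases b
  · exact absurd rfl hab
  · exact partialConj_cyc3_cyc4
  · exact partialConj_cyc3_cyc5
  · exact partialConj_cyc3_cyc4.symm
  · exact absurd rfl hab
  · exact partialConj_cyc4_cyc5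
  · exact partialConj_cyc5_cyc3
  · exact partialConj_cyc5_cyc4
  · exact absurd rfl hab

/-- **HC decided for all finite products** of CM elliptic curves with CM by `ℚ(√-3)` or `ℚ(i)` and CM abelian
surfaces with CM by `ℚ(ζ₅)`, any CM types, any multiplicities. -/
theorem lef_hc_prodFin_cmObj_cyc345 {n : ℕ} (c : Fin (n + 1) → Fin 3) (Θ : ∀ j, CMType (cyc345 (c j))) :
    lefModel.HC (lefModel.prodFin n fun j => cmObj (cyc345 (c j)) (Θ j)) :=
  lef_hc_prodFin_cmObj_multi cyc345 finrank_cyc345_le partialConj_cyc345 c Θ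

end Headlines

end HodgeCM.Toy
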